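import Literature.RepresentationTheory.BorelWallach2000.U11TranslationOntoTheWallBlock
import HarnessLib

/-!
# `θ_off` TRIPLES the length on the wall block of `U(1,1)`: `ℓ_R(θ_off A) = 3 ℓ_R(A)`, and `θ_off A` is never completely reducible
# (Mazorchuk's Exercise 5.92 / (5.13) «`θ_{−1}^0 M(−1) ≅ P(−2)`» for every finite-length module, by exactness)

Family `hodge`, lane `lit-hodgefound` (foundations library; seat `lit-hodgefound-p39`, generation 29, row g29-#4); topic
`RepresentationTheory/BorelWallach2000`, namespace `…BorelWallach2000.U11TranslWallNat` (continued).  Sequel of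
`U11TranslationOntoTheWallFunctor` / `U11TranslationOntoTheWallBlock` (g29-#1/#2: `transl_eq_top_of_wall` — `θ_off A = A ⊗ F_{1,0}` on the wall
block —, the classification `linearEquiv_of_wallBlock` of the irreducibles `{D_{(a,a−1)}, D̄_{(1−a,−a)}}` of `𝒞_{χ(a,a−1)}` (Bump Thm. 2.5.4 (ii),
`k = 1`), and (5.10) `length_translTransl_wall`: `ℓ_R(θ_on θ_off A) = 2 ℓ_R(A)`), of `U11TranslationDiscreteSeriesLimit` (g27: `ℓ_R(N) = 3`,
`N = D_{(a,a−1)} ⊗ F_{1,0}` not completely reducible) and `U11TranslationAntiholomorphicDiscreteSeriesLimit` (the same for `D̄ ⊗ F_{1,0}`).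
Here: the length of `θ_off A` for EVERY finite-length `A` of the wall block, by the induction on the length of Cor. 7.209's proof, and the
failure of complete reducibility of `θ_off A` for every `A ≠ 0`.  Theorems only; 0 `sorry`, 0 new axioms, no named fact (net debt 0, D-0026).

## The sources, verbatim

* V. Mazorchuk, *Lectures on `𝔰𝔩₂(ℂ)`-modules* (2009) [Mazorchuk2009] (galaxy book panama:449511277199416, p. 141): «By Exercise 3.114 we have
  a short exact sequence `0 → M(0) → θ_{−1}^0 M(−1) → M(−2) → 0.` (5.13)»; **Exercise 5.92.** «Show that `θ_{−1}^0 M(−1) ≅ P(−2)`.»; proof of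
  Lemma 5.93: «`N = θ_{−1}^0 ∘ θ_0^{−1} L(−2) = θ_{−1}^0 M(−1) = P(−2)`, which is indecomposable».  (`M(0)` has length `2` and `M(−2) = L(−2)`,
  Thm. 3.16 (ii) / Cor. 3.19, so `P(−2)` has length `3`.)
* A. W. Knapp, D. A. Vogan, *Cohomological Induction and Unitary Representations* (1995) [KnappVogan1995]: §VII.8 (7.141) «This functor is
  exact, being the composition of three exact functors»; §VII.13 **Cor. 7.208** «… then `ψ_λ^{λ+μ}` carries `𝓕(𝔤, K)` into itself» with the
  Remark «… that the translation functors preserve finite length»; Cor. 7.209 (proof): «by induction on the length»; Cor. 7.207 (composition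
  series); §VII.1 Example 3 (7.12).
* D. Bump, *Automorphic Forms and Representations* (1997) [Bump1997], Thm. 2.5.4 (ii) («except that if `k = 1`, there are only two»).

## Dictionary (as in g29-#1/#2)

`R = GKRing G11`; the wall `a − b = 1`, `χ = χ(a,b)`, `χ′ = χ(a+1,b)`; `θ_off = ψ^{χ′}_{F_{1,0}} = transl · 1 0 χ′`, `θ_on = ψ^{χ}_{F_{1,−1}}`;
Mazorchuk's `M(−1) ↔` an irreducible `S` of the wall block (`D_{(a,a−1)} = dsMod a b` or `D̄_{(1−a,−a)} = dsBarMod (−b) (−a)`),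
`P(−2) = θ_{−1}^0 M(−1) ↔ θ_off S` (`= S ⊗ F_{1,0}`, of length `3`).

## What is formalised

* §1 the irreducibles: **`length_translOff_dsMod`**, **`length_translOff_dsBarMod`** (`ℓ_R(θ_off D) = ℓ_R(θ_off D̄) = 3`),
  `not_isSemisimpleModule_translOff_dsMod/dsBarMod`, and for EVERY irreducible `S ∈ 𝒞_{χ(a,a−1)}` (classification + `translEquiv`):
  **`length_translOff_of_simple`** (`ℓ_R(θ_off S) = 3`), **`not_isSemisimpleModule_translOff_of_simple`**.
* §2 the induction (`length_translOff_of_subsingleton`, `length_translOff_of_submodule` — `ℓ(θ_off A) = ℓ(θ_off W) + ℓ(θ_off(A/W))` by the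
  lineage's `U11Transl.length_transl_eq_add`, (7.141) —, `length_translOff_of_length_le`) and the headline **`length_translOff_wall`:
  `ℓ_R(θ_off A) = 3 · ℓ_R(A)` for every finite-length `A ∈ 𝒞_{χ(a,a−1)}`**, `a − b = 1`; **`isFiniteLength_translOff_wall`** (Cor. 7.208 on the wall
  block, with the exact factor); **`length_translOff_eq_add_wall`**: `ℓ_R(θ_off A) = ℓ_R(A) + ℓ_R(θ_on θ_off A)` (with (5.10): translating back onto
  the wall loses exactly `ℓ_R(A)` composition factors).
* §3 **`not_isSemisimpleModule_translOff_wall`**: `θ_off A` is not completely reducible for any finite-length `A ≠ 0` of the wall block (an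
  irreducible submodule `Y ≤ A` exists — an atom of the Artinian lattice —, `θ_off Y ↪ θ_off A` by exactness, submodules of completely reducible
  modules are completely reducible, and §1).

Deviations (declared): (i) Mazorchuk's `O_{−1}` has one simple object and `P(−2)` is described by its Verma flag; here the wall block has two
irreducibles and the length `3` of `θ_off S` comes from the lineage's explicit chains in `S ⊗ F_{1,0}` (g27), transported along the
classification over `R`; (ii) the statements are about lengths and complete reducibility over `R = GKRing G11` (`IsFiniteLength`,
`IsSemisimpleModule`; KV App. A §3, Cor. 7.207), the universe of the irreducibles being that of `A`; (iii) no statement about `P(−2)` as a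
projective object is made (the category `𝒞(𝔤, K)` of the lineage has no projectives on record).

NOT here: the socle/top of `θ_off A`; the indecomposability of `θ_off A` for indecomposable `A` (true for irreducible `A`: g28
`U11TranslWall`, through the wall); Lemma 5.93 / Thm. 5.94 (functors); nothing here is a case of the Hodge conjecture.

Consumed by name: g29-#1/#2 `U11TranslWallNat.transl_eq_top_of_wall`, `linearEquiv_of_wallBlock`, `length_translTransl_wall` (`U11TranslationOntoTheWallFunctor`,
`U11TranslationOntoTheWallBlock`); `U11TranslDSLim.length_eq_three`, `not_isSemisimpleModule` (`U11TranslationDiscreteSeriesLimit`);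
`U11TranslDSLimBar.length_eq_three'`, `not_isSemisimpleModule'` (`U11TranslationAntiholomorphicDiscreteSeriesLimit`); `U11TranslCounit.hasGenInfChar_dsBarMod_block`,
`subsingleton_tensorFin`, `exists_ne_bot_ne_top`, `length_le_of_submodule` (`U11TranslationZuckermanIntegralBlocks`, `…Counit`); `U11Transl.length_transl_eq_add`,
`translEquiv`, `translMap_injective` (`U11TranslationFunctors`); `U11Primary.hasGenInfChar_submodule/_quotient`; `GKRing.isGKModule_submodule/_quotient`
(`GKModuleRing`); Mathlib `Module.length_eq_add_of_exact`, `Module.length_eq_one`, `Module.length_eq_zero(_iff)`, `Module.length_ne_top_iff`,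
`LinearEquiv.length_eq`, `LinearEquiv.isSemisimpleModule_iff`, `IsSemisimpleModule.submodule`, `isAtomic_of_orderBot_wellFounded_lt`,
`isSimpleModule_iff_isAtom`, `isFiniteLength_iff_isNoetherian_isArtinian`.

## References

* V. Mazorchuk, *Lectures on `𝔰𝔩₂(ℂ)`-modules*, Imperial College Press (2009), §5.8 Prop. 5.90 (5.10), (5.13), Exercise 5.92, Lemma 5.93 (proof);
  §3 Thm. 3.16 (ii), Cor. 3.19 (galaxy panama:449511277199416, p. 141). [Mazorchuk2009]
* A. W. Knapp, D. A. Vogan, *Cohomological Induction and Unitary Representations*, Princeton Math. Ser. 45 (1995), §VII.1 Example 3 (7.12);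
  §VII.8 (7.141); §VII.13 Cor. 7.207, Cor. 7.208, Cor. 7.209 (proof); App. A §3. [KnappVogan1995]
* D. Bump, *Automorphic Forms and Representations* (1997), §2.5 Thm. 2.5.4 (ii). [Bump1997]
* A. Borel, N. Wallach, *Continuous Cohomology, Discrete Subgroups, and Representations of Reductive Groups*, 2nd ed. (2000), 0 §2.5 (1). [BorelWallach2000]
-/

noncomputable section

open scoped Matrix ComplexConjugate TensorProduct
open Polynomial

namespace Literature.RepresentationTheory.BorelWallach2000

open Literature.Algebra.Lie Literature.Algebra.Lie.ChevalleyEilenberg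
open Literature.NumberTheory.Automorphic
open Literature.RepresentationTheory.KonnoKonno2007 Literature.RepresentationTheory.KonnoKonno2007.RealDualPair
open Literature.RepresentationTheory.KonnoKonno2007.RealDualPair.UForm
open U11HolDS

-- carriers `↥W`, `A ⧸ W` over `GKRing G11` with their `ℂ`-structures (as in `GKModuleRing` §7–§8)
set_option maxSynthPendingDepth 4

namespace U11TranslWallNat

open U11FinRep (Fm kAct lieAct)
open U11Transl (tensorFin transl translMap translEquiv isGKModule_tensorFin isGKModule_transl)
open U11Primary (HasGenInfChar primary)
open U11HC (IsZCFinite)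
open U11TranslDS (dsMod isGKModule_dsMod zScalarDS cScalarDS hasGenInfChar_dsMod)
open U11TranslDSLimConj (dsBarMod isGKModule_dsBarMod)

/-! ## §1 The irreducibles of the wall block: `ℓ_R(θ_off S) = 3` and `θ_off S` is not completely reducible -/

section Irreducibles

universe u

variable (a b : ℤ)

/-- **`ℓ_R(θ_off D_{(a,a−1)}) = 3`**: `θ_off D = D ⊗ F_{1,0} = N` (`transl_eq_top_of_wall`) and `ℓ_R(N) = 3` (the lineage's
`U11TranslDSLim.length_eq_three`: `0 ⊂ X·D_{(a+1,a−1)} ⊂ w₋(D_{(a,a)}) ⊂ N`) — «`θ_{−1}^0 M(−1) ≅ P(−2)`», of length `3` by (5.13).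
[cite: Mazorchuk2009, Exercise 5.92, (5.13)] [cite: KnappVogan1995, §VII.1 Example 3 (7.12)] -/
theorem length_translOff_dsMod (h : a - b = 1) :
    Module.length (GKRing G11) (transl (isGKModule_dsMod a b) 1 0 (zScalarDS (a + 1) b) (cScalarDS (a + 1) b)) = 3 :=
  (LinearEquiv.ofTop _ (transl_eq_top_of_wall a b (isGKModule_dsMod a b) (hasGenInfChar_dsMod a b) h)).length_eq.trans
    (U11TranslDSLim.length_eq_three a b h)

/-- **`ℓ_R(θ_off D̄_{(1−a,−a)}) = 3`** likewise (`U11TranslDSLimBar.length_eq_three'` at the antiholomorphic parameter `(−b, −a)`).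
[cite: Mazorchuk2009, Exercise 5.92, (5.13)] [cite: KnappVogan1995, §VII.1 Example 3 (7.12)] [cite: Bump1997, Thm. 2.5.4 (ii)] -/
theorem length_translOff_dsBarMod (h : a - b = 1) :
    Module.length (GKRing G11) (transl (isGKModule_dsBarMod (-b) (-a)) 1 0 (zScalarDS (a + 1) b) (cScalarDS (a + 1) b)) = 3 :=
  (LinearEquiv.ofTop _ (transl_eq_top_of_wall a b (isGKModule_dsBarMod (-b) (-a)) (U11TranslCounit.hasGenInfChar_dsBarMod_block a b) h)).length_eq.trans
    (U11TranslDSLimBar.length_eq_three' (-b) (-a) (by omega))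

/-- `θ_off D_{(a,a−1)} = N` is NOT completely reducible («`P(−2)` is indecomposable», the lineage's `U11TranslDSLim.not_isSemisimpleModule`).
[cite: Mazorchuk2009, Exercise 5.92, Cor. 3.19] [cite: KnappVogan1995, §VII.1 Example 3 (7.12)] -/
theorem not_isSemisimpleModule_translOff_dsMod (h : a - b = 1) :
    ¬ IsSemisimpleModule (GKRing G11) (transl (isGKModule_dsMod a b) 1 0 (zScalarDS (a + 1) b) (cScalarDS (a + 1) b)) := fun hs =>
  U11TranslDSLim.not_isSemisimpleModule a b h
    ((LinearEquiv.ofTop _ (transl_eq_top_of_wall a b (isGKModule_dsMod a b) (hasGenInfChar_dsMod a b) h)).isSemisimpleModule_iff.mp hs)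

/-- `θ_off D̄_{(1−a,−a)}` is NOT completely reducible (`U11TranslDSLimBar.not_isSemisimpleModule'`). [cite: Mazorchuk2009, Exercise 5.92, Cor. 3.19]
[cite: KnappVogan1995, §VII.1 Example 3 (7.12)] -/
theorem not_isSemisimpleModule_translOff_dsBarMod (h : a - b = 1) :
    ¬ IsSemisimpleModule (GKRing G11) (transl (isGKModule_dsBarMod (-b) (-a)) 1 0 (zScalarDS (a + 1) b) (cScalarDS (a + 1) b)) := fun hs =>
  U11TranslDSLimBar.not_isSemisimpleModule' (-b) (-a) (by omega)
    ((LinearEquiv.ofTop _ (transl_eq_top_of_wall a b (isGKModule_dsBarMod (-b) (-a)) (U11TranslCounit.hasGenInfChar_dsBarMod_block a b)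
      h)).isSemisimpleModule_iff.mp hs)

variable {S : Type u} [AddCommGroup S] [Module ℂ S] [Module (GKRing G11) S] [IsScalarTower ℂ (GKRing G11) S]
  (hS : IsGKModule G11 (GKRing.actK G11 S) (GKRing.actLie G11 S))
  (hSχ : HasGenInfChar (GKRing.actLie G11 S) (zScalarDS a b) (cScalarDS a b))

include hSχ in
/-- **`ℓ_R(θ_off S) = 3` for EVERY irreducible `S` of the wall block** (`S ≅ D_{(a,a−1)}` or `S ≅ D̄_{(1−a,−a)}` over `R`, Bump Thm. 2.5.4 (ii)
at `k = 1`, `linearEquiv_of_wallBlock`; `θ_off` of an `R`-isomorphism is an `R`-isomorphism, `translEquiv`) — the `U(1,1)` form of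
«`θ_{−1}^0 M(−1) ≅ P(−2)`» with (5.13) `0 → M(0) → θ_{−1}^0 M(−1) → M(−2) → 0`. [cite: Mazorchuk2009, Exercise 5.92, (5.13)] [cite: Bump1997, Thm. 2.5.4 (ii)] -/
theorem length_translOff_of_simple (h : a - b = 1) [IsSimpleModule (GKRing G11) S] :
    Module.length (GKRing G11) (transl hS 1 0 (zScalarDS (a + 1) b) (cScalarDS (a + 1) b)) = 3 :=
  (linearEquiv_of_wallBlock a b h hS hSχ).elim
    (fun hD => hD.elim fun e =>
      (translEquiv (isGKModule_dsMod a b) hS 1 0 (zScalarDS (a + 1) b) (cScalarDS (a + 1) b) e).length_eq.symm.trans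
        (length_translOff_dsMod a b h))
    fun hB => hB.elim fun e =>
      (translEquiv (isGKModule_dsBarMod (-b) (-a)) hS 1 0 (zScalarDS (a + 1) b) (cScalarDS (a + 1) b) e).length_eq.symm.trans
        (length_translOff_dsBarMod a b h)

include hSχ in
/-- **`θ_off S` is not completely reducible for every irreducible `S` of the wall block** — translation off the wall turns each irreducible
into a non-semisimple module of length `3` («`P(−2)`»). [cite: Mazorchuk2009, Exercise 5.92, Cor. 3.19] [cite: Bump1997, Thm. 2.5.4 (ii)] -/
theorem not_isSemisimpleModule_translOff_of_simple (h : a - b = 1) [IsSimpleModule (GKRing G11) S] :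
    ¬ IsSemisimpleModule (GKRing G11) (transl hS 1 0 (zScalarDS (a + 1) b) (cScalarDS (a + 1) b)) := fun hs =>
  (linearEquiv_of_wallBlock a b h hS hSχ).elim
    (fun hD => hD.elim fun e => not_isSemisimpleModule_translOff_dsMod a b h
      ((translEquiv (isGKModule_dsMod a b) hS 1 0 (zScalarDS (a + 1) b) (cScalarDS (a + 1) b) e).isSemisimpleModule_iff.mpr hs))
    fun hB => hB.elim fun e => not_isSemisimpleModule_translOff_dsBarMod a b h
      ((translEquiv (isGKModule_dsBarMod (-b) (-a)) hS 1 0 (zScalarDS (a + 1) b) (cScalarDS (a + 1) b) e).isSemisimpleModule_iff.mpr hs)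

end Irreducibles

/-! ## §2 The induction on the length: `ℓ_R(θ_off A) = 3 ℓ_R(A)` on the finite-length wall block -/

section Engine

universe u

variable (a b : ℤ)
variable {A : Type u} [AddCommGroup A] [Module ℂ A] [Module (GKRing G11) A] [IsScalarTower ℂ (GKRing G11) A]
  (hA : IsGKModule G11 (GKRing.actK G11 A) (GKRing.actLie G11 A))
  (hAχ : HasGenInfChar (GKRing.actLie G11 A) (zScalarDS a b) (cScalarDS a b))

/-- `θ_off 0 = 0` (plumbing for the induction). [cite: KnappVogan1995, §VII.8 (7.141)] -/
theorem length_translOff_of_subsingleton [Subsingleton A] :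
    Module.length (GKRing G11) (transl hA 1 0 (zScalarDS (a + 1) b) (cScalarDS (a + 1) b)) = 3 * Module.length (GKRing G11) A := by
  haveI : Subsingleton (tensorFin A 1 0) := U11TranslCounit.subsingleton_tensorFin 1 0
  rw [Module.length_eq_zero (M := A), mul_zero]
  exact Module.length_eq_zero

include hAχ in
/-- The inductive step: **`ℓ(θ_off A) = ℓ(θ_off W) + ℓ(θ_off (A/W))`** (`θ_off` is exact, (7.141); the lineage's `U11Transl.length_transl_eq_add`)
and `ℓ(A) = ℓ(W) + ℓ(A/W)`. [cite: KnappVogan1995, §VII.8 (7.141), §VII.13 Cor. 7.209 (proof)] -/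
theorem length_translOff_of_submodule (W : Submodule (GKRing G11) A)
    (hW : Module.length (GKRing G11) (transl (GKRing.isGKModule_submodule G11 A W hA) 1 0 (zScalarDS (a + 1) b) (cScalarDS (a + 1) b)) =
      3 * Module.length (GKRing G11) W)
    (hQ : Module.length (GKRing G11) (transl (GKRing.isGKModule_quotient G11 A W hA) 1 0 (zScalarDS (a + 1) b) (cScalarDS (a + 1) b)) =
      3 * Module.length (GKRing G11) (A ⧸ W)) :
    Module.length (GKRing G11) (transl hA 1 0 (zScalarDS (a + 1) b) (cScalarDS (a + 1) b)) = 3 * Module.length (GKRing G11) A := by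
  rw [U11Transl.length_transl_eq_add hA hAχ.isZCFinite 1 0 (zScalarDS (a + 1) b) (cScalarDS (a + 1) b) W, hW, hQ, ← mul_add,
    ← Module.length_eq_add_of_exact W.subtype W.mkQ (Submodule.subtype_injective W) (Submodule.mkQ_surjective W) (LinearMap.exact_subtype_mkQ W)]

/-- **The induction on the length** (as in Cor. 7.209's proof): `ℓ_R(θ_off B) = 3 ℓ_R(B)` for every `B` of the wall block with `ℓ_R(B) ≤ k`.
[cite: KnappVogan1995, §VII.13 Cor. 7.209 (proof)] [cite: Mazorchuk2009, Exercise 5.92, (5.13)] -/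
theorem length_translOff_of_length_le (h : a - b = 1) :
    ∀ (k : ℕ) (B : Type u) [AddCommGroup B] [Module ℂ B] [Module (GKRing G11) B] [IsScalarTower ℂ (GKRing G11) B]
      (hB : IsGKModule G11 (GKRing.actK G11 B) (GKRing.actLie G11 B)) (_hBχ : HasGenInfChar (GKRing.actLie G11 B) (zScalarDS a b) (cScalarDS a b)),
      Module.length (GKRing G11) B ≤ (k : ℕ) →
        Module.length (GKRing G11) (transl hB 1 0 (zScalarDS (a + 1) b) (cScalarDS (a + 1) b)) = 3 * Module.length (GKRing G11) B := by
  intro k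
  induction k with
  | zero =>
    intro B _ _ _ _ hB _ hle
    haveI : Subsingleton B := by
      rw [Nat.cast_zero, nonpos_iff_eq_zero, Module.length_eq_zero_iff] at hle
      exact hle
    exact length_translOff_of_subsingleton a b hB
  | succ k ih =>
    intro B _ _ _ _ hB hBχ hle
    by_cases h0 : Subsingleton B
    · exact length_translOff_of_subsingleton a b hB
    haveI : Nontrivial B := not_subsingleton_iff_nontrivial.mp h0
    by_cases hs : IsSimpleModule (GKRing G11) B
    · haveI := hs
      rw [length_translOff_of_simple a b hB hBχ h, Module.length_eq_one, mul_one]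
    exact (U11TranslCounit.exists_ne_bot_ne_top hs).elim fun W hW =>
      (U11TranslCounit.length_le_of_submodule k W hle hW.1 hW.2).elim fun hCle hBle =>
        length_translOff_of_submodule a b hB hBχ W (ih W _ (U11Primary.hasGenInfChar_submodule W hBχ) hCle)
          (ih (B ⧸ W) _ (U11Primary.hasGenInfChar_quotient W hBχ) hBle)

/-- **`θ_off` TRIPLES THE LENGTH on the finite-length wall block: `ℓ_R(θ_off A) = 3 · ℓ_R(A)`** for every `(𝔤, K)`-module `A` over `R` of finite
length with the wall generalized infinitesimal character `χ(a,a−1)`, `a − b = 1` — (5.13)/Exercise 5.92 («`θ_{−1}^0 M(−1) ≅ P(−2)`», length `3`)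
for every module of `O_{−1}` by exactness; in particular Cor. 7.208 («the translation functors preserve finite length») with the exact factor.
[cite: Mazorchuk2009, Exercise 5.92, (5.13)] [cite: KnappVogan1995, §VII.8 (7.141), §VII.13 Cor. 7.208, Cor. 7.209 (proof)] [cite: Bump1997, Thm. 2.5.4 (ii)] -/
theorem length_translOff_wall (hAχ : HasGenInfChar (GKRing.actLie G11 A) (zScalarDS a b) (cScalarDS a b)) (h : a - b = 1) (hfl : IsFiniteLength (GKRing G11) A) :
    Module.length (GKRing G11) (transl hA 1 0 (zScalarDS (a + 1) b) (cScalarDS (a + 1) b)) = 3 * Module.length (GKRing G11) A :=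
  (ENat.ne_top_iff_exists.mp (Module.length_ne_top_iff.mpr hfl)).elim fun k hk =>
    length_translOff_of_length_le a b h k A hA hAχ hk.symm.le

include hAχ in
/-- **Cor. 7.208 on the wall block: `θ_off A` has finite length** (`= 3 ℓ(A) < ∞`). [cite: KnappVogan1995, §VII.13 Cor. 7.208] -/
theorem isFiniteLength_translOff_wall (h : a - b = 1) (hfl : IsFiniteLength (GKRing G11) A) :
    IsFiniteLength (GKRing G11) (transl hA 1 0 (zScalarDS (a + 1) b) (cScalarDS (a + 1) b)) := by
  refine Module.length_ne_top_iff.mp ?_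
  rw [length_translOff_wall a b hA hAχ h hfl]
  exact WithTop.mul_ne_top (by decide) (Module.length_ne_top_iff.mpr hfl)

include hAχ in
/-- **`ℓ_R(θ_off A) = ℓ_R(A) + ℓ_R(θ_on θ_off A)`** (`3 ℓ = ℓ + 2 ℓ`, with (5.10)'s `length_translTransl_wall`): translating `θ_off A` back onto
the wall loses exactly `ℓ_R(A)` composition factors — one per irreducible constituent of `A` (for `S = D_{(a,a−1)}`: the constituent of
`D_{(a,a)} ⊂ N` killed by `θ_on`, `U11TranslWall.length_transl_wall`). [cite: Mazorchuk2009, Prop. 5.90 (5.10), (5.13)] [cite: KnappVogan1995, §VII.13 Cor. 7.209] -/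
theorem length_translOff_eq_add_wall (h : a - b = 1) (hfl : IsFiniteLength (GKRing G11) A) :
    Module.length (GKRing G11) (transl hA 1 0 (zScalarDS (a + 1) b) (cScalarDS (a + 1) b)) =
      Module.length (GKRing G11) A +
        Module.length (GKRing G11) (transl (isGKModule_transl hA 1 0 (zScalarDS (a + 1) b) (cScalarDS (a + 1) b)) 1 (-1) (zScalarDS a b) (cScalarDS a b)) := by
  rw [length_translOff_wall a b hA hAχ h hfl, length_translTransl_wall a b hA hAχ h hfl]
  ring

end Engine

/-! ## §3 `θ_off A` is never completely reducible (`A ≠ 0` of finite length in the wall block) -/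

section NotSemisimple

universe u

variable (a b : ℤ)
variable {A : Type u} [AddCommGroup A] [Module ℂ A] [Module (GKRing G11) A] [IsScalarTower ℂ (GKRing G11) A]
  (hA : IsGKModule G11 (GKRing.actK G11 A) (GKRing.actLie G11 A))
  (hAχ : HasGenInfChar (GKRing.actLie G11 A) (zScalarDS a b) (cScalarDS a b))

include hAχ in
/-- **`θ_off A` is NOT completely reducible for any non-zero finite-length `A` of the wall block**: `A` has an irreducible submodule `Y`
(an atom of its Artinian submodule lattice), `θ_off Y ↪ θ_off A` (`θ_off` is exact), and a submodule of a completely reducible module is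
completely reducible — but `θ_off Y` is not (§1). [cite: Mazorchuk2009, Exercise 5.92, Cor. 3.19] [cite: KnappVogan1995, §VII.8 (7.141), §VII.13 Cor. 7.207] -/
theorem not_isSemisimpleModule_translOff_wall (h : a - b = 1) (hfl : IsFiniteLength (GKRing G11) A) [Nontrivial A] :
    ¬ IsSemisimpleModule (GKRing G11) (transl hA 1 0 (zScalarDS (a + 1) b) (cScalarDS (a + 1) b)) := fun hs => by
  haveI : IsArtinian (GKRing G11) A := (isFiniteLength_iff_isNoetherian_isArtinian.mp hfl).2
  haveI : IsAtomic (Submodule (GKRing G11) A) := isAtomic_of_orderBot_wellFounded_lt wellFounded_lt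
  haveI := hs
  exact ((eq_bot_or_exists_atom_le (⊤ : Submodule (GKRing G11) A)).resolve_left top_ne_bot).elim fun Y hY => by
    haveI : IsSimpleModule (GKRing G11) Y := isSimpleModule_iff_isAtom.mpr hY.1
    exact not_isSemisimpleModule_translOff_of_simple a b (GKRing.isGKModule_submodule G11 A Y hA) (U11Primary.hasGenInfChar_submodule Y hAχ) h
      ((LinearEquiv.ofInjective _ (U11Transl.translMap_injective (GKRing.isGKModule_submodule G11 A Y hA) hA 1 0 (zScalarDS (a + 1) b)
        (cScalarDS (a + 1) b) Y.subtype (Submodule.subtype_injective Y))).isSemisimpleModule_iff.mpr inferInstance)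

end NotSemisimple

end U11TranslWallNat

end Literature.RepresentationTheory.BorelWallach2000
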